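import Literature.RepresentationTheory.Kovacevic2021.SU21GaugeEquivalence
import Literature.RepresentationTheory.Kovacevic2021.SU21VertexRigidity
import HarnessLib

/-!
# Existence of a gauge between two strongly connected `K`-type data for `SU(2,1)` with the same
# `K`-types, a common vertex and the same invariant products

Continuation of `Literature.RepresentationTheory.Kovacevic2021.SU21GaugeEquivalence` (a nowhere-zero gauge
`g` with `A₁ g' = g A₂`, … on every arrow landing in a `K`-type gives `𝒟₁.V ≃ₗ⁅ℂ, 𝔤𝔩₃⁆ 𝒟₂.V`) and
`SU21VertexRigidity` / `SU21ArrowReversal` (in a strongly connected datum adjacent `K`-types are linked by live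
arrows both ways; a local minimum `x₀` is unique and every other `K`-type has a lower neighbour).

**Statement proved** (`nonempty_equiv_of_products_eq`).  Let `𝒟₁`, `𝒟₂` be data with the same `K`-type set
`S`, both strongly connected (any `K`-type reachable from any other along live arrows), with a common local
minimum `x₀ ∈ S`, the same gauge-invariant products `A D'`, `B C'` [Kovacevic2021, Remark 3], and such that
`S` is *square-complete* (whenever `(n, m∓3)` and `(n+1, m)` are `K`-types so is `(n-1, m)` — true for the
rays, the point and the quadrant of the six cohomological modules).  Then `𝒟₁.V ≅ 𝒟₂.V` as
`𝔤𝔩(3,ℂ)`-modules.  This is the uniqueness half of [Kovacevic2021, §3 Thm 2] ("If the set of `K` types is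
given together with relations (b20)–(b45), then it is possible to reconstruct an irreducible `(𝔤,K)` module")
in the precise form: the `K`-types and the invariant products determine the module up to isomorphism.
Combined with `SU21CohomologicalClassification.exists_model_of_isIrreducible` this identifies an irreducible
cohomological datum with one of the six model modules up to isomorphism (`SU21IrreducibleModels`).

**Construction.**  The gauge is defined by recursion on the level `n` (`levelGauge`): `g(x₀) = 1`, and for a
`K`-type `y = (n+1, m) ≠ x₀`, `g(y) = g(x) A₂(x)/A₁(x)` if `x = (n, m-3) ∈ S`, else `g(y) = g(x') B₂(x')/B₁(x')`
with `x' = (n, m+3)`.  The gauge condition for `A`-arrows then holds by definition, the one for `B`-arrows by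
the commuting square (b30) `B A' = A B'` of both data (this is where square-completeness enters), and those
for `C`, `D` follow from the equality of the products (§3).

## What is here

* DEFINITION with body: `levelGauge 𝒟₁ 𝒟₂ x₀ : ℕ → ℤ → ℂ` (the recursion above);
* THEOREMS: `levelGauge_step` (the joint induction: non-vanishing and the `A`, `B` gauge conditions),
  `gaugeC_of_gaugeB`, `gaugeD_of_gaugeA` (§3), `nonempty_equiv_of_products_eq` (§4).

## References

* D. Kovačević, *Unitary `(𝔤,K)` modules of `SU(2,1)`*, Acta Math. Spalatensia 1 (2021) 105–125
  (arXiv:1810.01752): §3 Thm 2 (b30), Remark 3. [Kovacevic2021]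
* A. Borel, N. Wallach (2000), VI 4.8–4.11 (context: the six cohomological modules). [BorelWallach2000]
-/

noncomputable section

namespace Literature.RepresentationTheory.Kovacevic2021

-- Mathlib idiom (Mathlib/Algebra/Lie/OfAssociative.lean): commutator brackets on associative algebras; needed for
-- the `𝔤𝔩(3,ℂ)`-module structure on `𝒟.V`, as in every file of this directory.
attribute [local instance 100] LieRing.ofAssociativeRing

namespace SU21Datum

open Classical in
/-- **The gauge by recursion on the level.** `levelGauge 𝒟₁ 𝒟₂ x₀ N m` is the gauge factor at the
`K`-type `(N, m)`: `1` at the vertex `x₀` (and on the level `0`, where no `K`-type lives); otherwise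
transported from the lower neighbour `(N-1, m-3)` along its `A`-arrow if that is a `K`-type, else from
`(N-1, m+3)` along its `B`-arrow. [cite: Kovacevic2021, §3 Thm 2, Remark 3] -/
def levelGauge (𝒟₁ 𝒟₂ : SU21Datum) (x₀ : ℤ × ℤ) : ℕ → ℤ → ℂ
  | 0 => fun _ => 1
  | N + 1 => fun m =>
    if ((N : ℤ) + 1, m) = x₀ then 1
    else if ((N : ℤ), m - 3) ∈ 𝒟₁.S then
      levelGauge 𝒟₁ 𝒟₂ x₀ N (m - 3) * (𝒟₂.A N (m - 3) / 𝒟₁.A N (m - 3))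
    else levelGauge 𝒟₁ 𝒟₂ x₀ N (m + 3) * (𝒟₂.B N (m + 3) / 𝒟₁.B N (m + 3))

variable {𝒟₁ 𝒟₂ : SU21Datum} {x₀ : ℤ × ℤ}

/-- the recursion at the vertex [cite: Kovacevic2021, §3 Remark 3] -/
theorem levelGauge_vertex (N : ℕ) (m : ℤ) (h : ((N : ℤ) + 1, m) = x₀) :
    levelGauge 𝒟₁ 𝒟₂ x₀ (N + 1) m = 1 := by
  simp only [levelGauge]
  rw [if_pos h]

/-- the recursion along an `A`-arrow [cite: Kovacevic2021, §3 Remark 3] -/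
theorem levelGauge_A (N : ℕ) (m : ℤ) (h : ((N : ℤ) + 1, m) ≠ x₀) (hx : ((N : ℤ), m - 3) ∈ 𝒟₁.S) :
    levelGauge 𝒟₁ 𝒟₂ x₀ (N + 1) m =
      levelGauge 𝒟₁ 𝒟₂ x₀ N (m - 3) * (𝒟₂.A N (m - 3) / 𝒟₁.A N (m - 3)) := by
  simp only [levelGauge]
  rw [if_neg h, if_pos hx]

/-- the recursion along a `B`-arrow [cite: Kovacevic2021, §3 Remark 3] -/
theorem levelGauge_B (N : ℕ) (m : ℤ) (h : ((N : ℤ) + 1, m) ≠ x₀) (hx : ((N : ℤ), m - 3) ∉ 𝒟₁.S) :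
    levelGauge 𝒟₁ 𝒟₂ x₀ (N + 1) m =
      levelGauge 𝒟₁ 𝒟₂ x₀ N (m + 3) * (𝒟₂.B N (m + 3) / 𝒟₁.B N (m + 3)) := by
  simp only [levelGauge]
  rw [if_neg h, if_neg hx]

section Induction

variable (hS : 𝒟₁.S = 𝒟₂.S)
  (hconn₁ : ∀ x ∈ 𝒟₁.S, ∀ y ∈ 𝒟₁.S, 𝒟₁.Reach x y) (hconn₂ : ∀ x ∈ 𝒟₂.S, ∀ y ∈ 𝒟₂.S, 𝒟₂.Reach x y)
  (h₀ : x₀ ∈ 𝒟₁.S) (h₀D : (x₀.1 - 1, x₀.2 - 3) ∉ 𝒟₁.S) (h₀C : (x₀.1 - 1, x₀.2 + 3) ∉ 𝒟₁.S)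
  (hsq : ∀ n m : ℤ, (n, m - 3) ∈ 𝒟₁.S → (n, m + 3) ∈ 𝒟₁.S → (n + 1, m) ∈ 𝒟₁.S → (n - 1, m) ∈ 𝒟₁.S)

include hS hconn₁ hconn₂ h₀ h₀D h₀C hsq

/-- **The joint induction.** On every level `N`: the gauge is non-zero on the `K`-types; along every
`A`-arrow `(N, m-3) → (N+1, m)` between `K`-types `A₁ g' = g A₂`; along every `B`-arrow
`(N, m+3) → (N+1, m)` between `K`-types `B₁ g' = g B₂` (by the recursion, resp. by the commuting square
(b30) of both data one level down). [cite: Kovacevic2021, §3 Thm 2 (b30), Remark 3] -/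
theorem levelGauge_step (N : ℕ) :
    (∀ m : ℤ, ((N : ℤ), m) ∈ 𝒟₁.S → levelGauge 𝒟₁ 𝒟₂ x₀ N m ≠ 0) ∧
    (∀ m : ℤ, ((N : ℤ), m - 3) ∈ 𝒟₁.S → ((N : ℤ) + 1, m) ∈ 𝒟₁.S →
      𝒟₁.A N (m - 3) * levelGauge 𝒟₁ 𝒟₂ x₀ (N + 1) m = levelGauge 𝒟₁ 𝒟₂ x₀ N (m - 3) * 𝒟₂.A N (m - 3)) ∧
    (∀ m : ℤ, ((N : ℤ), m + 3) ∈ 𝒟₁.S → ((N : ℤ) + 1, m) ∈ 𝒟₁.S →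
      𝒟₁.B N (m + 3) * levelGauge 𝒟₁ 𝒟₂ x₀ (N + 1) m = levelGauge 𝒟₁ 𝒟₂ x₀ N (m + 3) * 𝒟₂.B N (m + 3)) := by
  -- liveness of the arrows between adjacent `K`-types, in both data
  have liveA₁ : ∀ n m : ℤ, (n, m) ∈ 𝒟₁.S → (n + 1, m + 3) ∈ 𝒟₁.S → 𝒟₁.A n m ≠ 0 :=
    fun n m hx hy => coef_ne_zero_of_forall_reach hconn₁ Dir.A hx hy
  have liveB₁ : ∀ n m : ℤ, (n, m) ∈ 𝒟₁.S → (n + 1, m - 3) ∈ 𝒟₁.S → 𝒟₁.B n m ≠ 0 :=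
    fun n m hx hy => coef_ne_zero_of_forall_reach hconn₁ Dir.B hx hy
  have liveA₂ : ∀ n m : ℤ, (n, m) ∈ 𝒟₁.S → (n + 1, m + 3) ∈ 𝒟₁.S → 𝒟₂.A n m ≠ 0 :=
    fun n m hx hy => coef_ne_zero_of_forall_reach hconn₂ Dir.A (by rw [← hS]; exact hx) (by rw [← hS]; exact hy)
  have liveB₂ : ∀ n m : ℤ, (n, m) ∈ 𝒟₁.S → (n + 1, m - 3) ∈ 𝒟₁.S → 𝒟₂.B n m ≠ 0 :=
    fun n m hx hy => coef_ne_zero_of_forall_reach hconn₂ Dir.B (by rw [← hS]; exact hx) (by rw [← hS]; exact hy)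
  -- a `K`-type with a lower neighbour is not the vertex
  have ne₀A : ∀ n m : ℤ, (n, m - 3) ∈ 𝒟₁.S → (n + 1, m) ≠ x₀ := by
    rintro n m hx rfl
    exact h₀D (by simpa using hx)
  have ne₀B : ∀ n m : ℤ, (n, m + 3) ∈ 𝒟₁.S → (n + 1, m) ≠ x₀ := by
    rintro n m hx rfl
    exact h₀C (by simpa using hx)
  -- every `K`-type other than the vertex has a lower neighbour
  have lower : ∀ n m : ℤ, (n, m) ∈ 𝒟₁.S → (n, m) ≠ x₀ → (n - 1, m - 3) ∈ 𝒟₁.S ∨ (n - 1, m + 3) ∈ 𝒟₁.S := by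
    intro n m hy hne
    rcases exists_lower_of_ne hconn₁ h₀ h₀D h₀C hy hne with h | h
    · exact Or.inl (mem_of_coef_ne_zero Dir.A (left_ne_zero_of_mul h))
    · exact Or.inr (mem_of_coef_ne_zero Dir.B (left_ne_zero_of_mul h))
  induction N with
  | zero =>
    refine ⟨fun m h => ?_, fun m h _ => ?_, fun m h _ => ?_⟩
    all_goals
      have := 𝒟₁.one_le_of_mem h
      simp at this
  | succ N ih =>
    obtain ⟨ihnz, ihA, ihB⟩ := ih
    refine ⟨fun m hy => ?_, fun m hx hy => ?_, fun m hx' hy => ?_⟩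
    · -- non-vanishing on the level `N + 1`
      have hy1 : ((N : ℤ) + 1, m) ∈ 𝒟₁.S := by simpa using hy
      by_cases hv : ((N : ℤ) + 1, m) = x₀
      · rw [levelGauge_vertex N m hv]; exact one_ne_zero
      rcases lower _ m hy1 hv with hx | hx
      · have hx1 : ((N : ℤ), m - 3) ∈ 𝒟₁.S := by simpa using hx
        have hy' : ((N : ℤ) + 1, m - 3 + 3) ∈ 𝒟₁.S := by simpa using hy1
        rw [levelGauge_A N m hv hx1]
        exact mul_ne_zero (ihnz _ hx1) (div_ne_zero (liveA₂ _ _ hx1 hy') (liveA₁ _ _ hx1 hy'))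
      · have hx1 : ((N : ℤ), m + 3) ∈ 𝒟₁.S := by simpa using hx
        by_cases hx2 : ((N : ℤ), m - 3) ∈ 𝒟₁.S
        · have hy' : ((N : ℤ) + 1, m - 3 + 3) ∈ 𝒟₁.S := by simpa using hy1
          rw [levelGauge_A N m hv hx2]
          exact mul_ne_zero (ihnz _ hx2) (div_ne_zero (liveA₂ _ _ hx2 hy') (liveA₁ _ _ hx2 hy'))
        · have hy' : ((N : ℤ) + 1, m + 3 - 3) ∈ 𝒟₁.S := by simpa using hy1
          rw [levelGauge_B N m hv hx2]
          exact mul_ne_zero (ihnz _ hx1) (div_ne_zero (liveB₂ _ _ hx1 hy') (liveB₁ _ _ hx1 hy'))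
    · -- the `A`-condition on the arrows `(N+1, m-3) → (N+2, m)`: by the recursion
      have ha : 𝒟₁.A ((N + 1 : ℕ) : ℤ) (m - 3) ≠ 0 := liveA₁ _ _ hx (by simpa using hy)
      rw [levelGauge_A (N + 1) m (ne₀A _ m hx) hx]
      field_simp
    · -- the `B`-condition on the arrows `(N+1, m+3) → (N+2, m)`
      have hv : (((N + 1 : ℕ) : ℤ) + 1, m) ≠ x₀ := ne₀B _ m hx'
      have hb : 𝒟₁.B ((N + 1 : ℕ) : ℤ) (m + 3) ≠ 0 := liveB₁ _ _ hx' (by simpa using hy)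
      by_cases hx2 : (((N + 1 : ℕ) : ℤ), m - 3) ∈ 𝒟₁.S
      · -- both lower neighbours are `K`-types: the commuting square one level down
        have ha : 𝒟₁.A ((N + 1 : ℕ) : ℤ) (m - 3) ≠ 0 := liveA₁ _ _ hx2 (by simpa using hy)
        rw [levelGauge_A (N + 1) m hv hx2]
        have hx2' : ((N : ℤ) + 1, m - 3) ∈ 𝒟₁.S := by simpa using hx2
        have hx'' : ((N : ℤ) + 1, m + 3) ∈ 𝒟₁.S := by simpa using hx'
        have hy'' : ((N : ℤ) + 1 + 1, m) ∈ 𝒟₁.S := by simpa using hy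
        have hz : ((N : ℤ), m) ∈ 𝒟₁.S := by simpa using hsq _ m hx2' hx'' hy''
        have hbz : 𝒟₁.B (N : ℤ) m ≠ 0 := liveB₁ _ _ hz hx2'
        have haz : 𝒟₁.A (N : ℤ) m ≠ 0 := liveA₁ _ _ hz hx''
        have eB := ihB (m - 3) (by simpa using hz) hx2'
        have eA := ihA (m + 3) (by simpa using hz) hx''
        simp only [sub_add_cancel, add_sub_cancel_right] at eB eA
        have r₁ := 𝒟₁.rel30 N m
        have r₂ := 𝒟₂.rel30 N m
        push_cast at ha hb ⊢
        have key : 𝒟₁.A (N : ℤ) m * 𝒟₁.B (N : ℤ) m *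
            (𝒟₁.B ((N : ℤ) + 1) (m + 3) * levelGauge 𝒟₁ 𝒟₂ x₀ (N + 1) (m - 3) * 𝒟₂.A ((N : ℤ) + 1) (m - 3)
              - levelGauge 𝒟₁ 𝒟₂ x₀ (N + 1) (m + 3) * 𝒟₂.B ((N : ℤ) + 1) (m + 3)
                * 𝒟₁.A ((N : ℤ) + 1) (m - 3)) = 0 := by
          linear_combination
            (𝒟₁.A (N : ℤ) m * 𝒟₁.B ((N : ℤ) + 1) (m + 3) * 𝒟₂.A ((N : ℤ) + 1) (m - 3)) * eB
            - (𝒟₁.B (N : ℤ) m * 𝒟₂.B ((N : ℤ) + 1) (m + 3) * 𝒟₁.A ((N : ℤ) + 1) (m - 3)) * eA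
            + (levelGauge 𝒟₁ 𝒟₂ x₀ N m * 𝒟₁.A (N : ℤ) m * 𝒟₁.B ((N : ℤ) + 1) (m + 3)) * r₂
            - (levelGauge 𝒟₁ 𝒟₂ x₀ N m * 𝒟₂.B ((N : ℤ) + 1) (m + 3) * 𝒟₂.A (N : ℤ) m) * r₁
        have hE : 𝒟₁.B ((N : ℤ) + 1) (m + 3) * levelGauge 𝒟₁ 𝒟₂ x₀ (N + 1) (m - 3) * 𝒟₂.A ((N : ℤ) + 1) (m - 3)
            = levelGauge 𝒟₁ 𝒟₂ x₀ (N + 1) (m + 3) * 𝒟₂.B ((N : ℤ) + 1) (m + 3) * 𝒟₁.A ((N : ℤ) + 1) (m - 3) :=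
          sub_eq_zero.1 ((mul_eq_zero.1 key).resolve_left (mul_ne_zero haz hbz))
        calc 𝒟₁.B ((N : ℤ) + 1) (m + 3) * (levelGauge 𝒟₁ 𝒟₂ x₀ (N + 1) (m - 3)
                * (𝒟₂.A ((N : ℤ) + 1) (m - 3) / 𝒟₁.A ((N : ℤ) + 1) (m - 3)))
            = 𝒟₁.B ((N : ℤ) + 1) (m + 3) * levelGauge 𝒟₁ 𝒟₂ x₀ (N + 1) (m - 3) * 𝒟₂.A ((N : ℤ) + 1) (m - 3)
                / 𝒟₁.A ((N : ℤ) + 1) (m - 3) := by ring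
          _ = levelGauge 𝒟₁ 𝒟₂ x₀ (N + 1) (m + 3) * 𝒟₂.B ((N : ℤ) + 1) (m + 3) * 𝒟₁.A ((N : ℤ) + 1) (m - 3)
                / 𝒟₁.A ((N : ℤ) + 1) (m - 3) := by rw [hE]
          _ = levelGauge 𝒟₁ 𝒟₂ x₀ (N + 1) (m + 3) * 𝒟₂.B ((N : ℤ) + 1) (m + 3) :=
                mul_div_cancel_right₀ _ ha
      · rw [levelGauge_B (N + 1) m hv hx2]
        push_cast at hb ⊢
        field_simp

end Induction

/-! ## §3 The `C`- and `D`-conditions follow from the equality of the products -/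

/-- **`C` from `B`.** If the products `B C'` agree and the `B`-condition holds on the arrows landing in
`K`-types, then so does the `C`-condition (the `B`-arrow into `(n,m)` from `(n-1,m+3)` is live).
[cite: Kovacevic2021, §3 Remark 3] -/
theorem gaugeC_of_gaugeB (hS : 𝒟₁.S = 𝒟₂.S) (hconn₁ : ∀ x ∈ 𝒟₁.S, ∀ y ∈ 𝒟₁.S, 𝒟₁.Reach x y)
    (hQ : ∀ n m : ℤ, 𝒟₁.B n m * 𝒟₁.C (n + 1) (m - 3) = 𝒟₂.B n m * 𝒟₂.C (n + 1) (m - 3))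
    {g : ℤ → ℤ → ℂ}
    (hB : ∀ n m : ℤ, (n + 1, m - 3) ∈ 𝒟₁.S → 𝒟₁.B n m * g (n + 1) (m - 3) = g n m * 𝒟₂.B n m)
    (n m : ℤ) (hx : (n - 1, m + 3) ∈ 𝒟₁.S) : 𝒟₁.C n m * g (n - 1) (m + 3) = g n m * 𝒟₂.C n m := by
  by_cases hy : (n, m) ∈ 𝒟₁.S
  · have hy' : (n - 1 + 1, m + 3 - 3) ∈ 𝒟₁.S := by simpa using hy
    have hb : 𝒟₁.B (n - 1) (m + 3) ≠ 0 := coef_ne_zero_of_forall_reach hconn₁ Dir.B hx hy'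
    have e1 := hB (n - 1) (m + 3) hy'
    have e2 := hQ (n - 1) (m + 3)
    simp only [sub_add_cancel, add_sub_cancel_right] at e1 e2
    apply mul_left_cancel₀ hb
    linear_combination g (n - 1) (m + 3) * e2 - 𝒟₂.C n m * e1
  · rw [𝒟₁.C_eq_zero hy, 𝒟₂.C_eq_zero (by rwa [← hS]), zero_mul, mul_zero]

/-- **`D` from `A`.** If the products `A D'` agree and the `A`-condition holds on the arrows landing in
`K`-types, then so does the `D`-condition. [cite: Kovacevic2021, §3 Remark 3] -/
theorem gaugeD_of_gaugeA (hS : 𝒟₁.S = 𝒟₂.S) (hconn₁ : ∀ x ∈ 𝒟₁.S, ∀ y ∈ 𝒟₁.S, 𝒟₁.Reach x y)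
    (hP : ∀ n m : ℤ, 𝒟₁.A n m * 𝒟₁.D (n + 1) (m + 3) = 𝒟₂.A n m * 𝒟₂.D (n + 1) (m + 3))
    {g : ℤ → ℤ → ℂ}
    (hA : ∀ n m : ℤ, (n + 1, m + 3) ∈ 𝒟₁.S → 𝒟₁.A n m * g (n + 1) (m + 3) = g n m * 𝒟₂.A n m)
    (n m : ℤ) (hx : (n - 1, m - 3) ∈ 𝒟₁.S) : 𝒟₁.D n m * g (n - 1) (m - 3) = g n m * 𝒟₂.D n m := by
  by_cases hy : (n, m) ∈ 𝒟₁.S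
  · have hy' : (n - 1 + 1, m - 3 + 3) ∈ 𝒟₁.S := by simpa using hy
    have ha : 𝒟₁.A (n - 1) (m - 3) ≠ 0 := coef_ne_zero_of_forall_reach hconn₁ Dir.A hx hy'
    have e1 := hA (n - 1) (m - 3) hy'
    have e2 := hP (n - 1) (m - 3)
    simp only [sub_add_cancel] at e1 e2
    apply mul_left_cancel₀ ha
    linear_combination g (n - 1) (m - 3) * e2 - 𝒟₂.D n m * e1
  · rw [𝒟₁.D_eq_zero hy, 𝒟₂.D_eq_zero (by rwa [← hS]), zero_mul, mul_zero]

/-! ## §4 The isomorphism -/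

/-- **Two strongly connected data with the same `K`-types, a common vertex, square-complete `K`-type set and
the same invariant products have isomorphic `𝔤𝔩(3,ℂ)`-modules** (the `K`-types and the products `A D'`,
`B C'` determine the module). [cite: Kovacevic2021, §3 Thm 2, Remark 3] -/
theorem nonempty_equiv_of_products_eq (hS : 𝒟₁.S = 𝒟₂.S)
    (hconn₁ : ∀ x ∈ 𝒟₁.S, ∀ y ∈ 𝒟₁.S, 𝒟₁.Reach x y) (hconn₂ : ∀ x ∈ 𝒟₂.S, ∀ y ∈ 𝒟₂.S, 𝒟₂.Reach x y)
    (h₀ : x₀ ∈ 𝒟₁.S) (h₀D : (x₀.1 - 1, x₀.2 - 3) ∉ 𝒟₁.S) (h₀C : (x₀.1 - 1, x₀.2 + 3) ∉ 𝒟₁.S)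
    (hsq : ∀ n m : ℤ, (n, m - 3) ∈ 𝒟₁.S → (n, m + 3) ∈ 𝒟₁.S → (n + 1, m) ∈ 𝒟₁.S → (n - 1, m) ∈ 𝒟₁.S)
    (hP : ∀ n m : ℤ, 𝒟₁.A n m * 𝒟₁.D (n + 1) (m + 3) = 𝒟₂.A n m * 𝒟₂.D (n + 1) (m + 3))
    (hQ : ∀ n m : ℤ, 𝒟₁.B n m * 𝒟₁.C (n + 1) (m - 3) = 𝒟₂.B n m * 𝒟₂.C (n + 1) (m - 3)) :
    Nonempty (𝒟₁.V ≃ₗ⁅ℂ, Matrix (Fin 3) (Fin 3) ℂ⁆ 𝒟₂.V) := by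
  let g : ℤ → ℤ → ℂ := fun n m => levelGauge 𝒟₁ 𝒟₂ x₀ n.toNat m
  have step := fun N => levelGauge_step hS hconn₁ hconn₂ h₀ h₀D h₀C hsq N
  -- transport from levels `N : ℕ` to `n : ℤ` (`n ≥ 1` on `S`)
  have cast : ∀ n m : ℤ, (n, m) ∈ 𝒟₁.S → ∃ N : ℕ, (n : ℤ) = N := fun n m h =>
    ⟨n.toNat, (Int.toNat_of_nonneg (by have := 𝒟₁.one_le_of_mem h; omega)).symm⟩
  have hg : ∀ n m : ℤ, (n, m) ∈ 𝒟₁.S → g n m ≠ 0 := by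
    intro n m h
    obtain ⟨N, rfl⟩ := cast n m h
    simpa [g] using (step N).1 m h
  have hA : ∀ n m : ℤ, (n + 1, m + 3) ∈ 𝒟₁.S → 𝒟₁.A n m * g (n + 1) (m + 3) = g n m * 𝒟₂.A n m := by
    intro n m hy
    by_cases hx : (n, m) ∈ 𝒟₁.S
    · obtain ⟨N, rfl⟩ := cast n m hx
      have := (step N).2.1 (m + 3) (by simpa using hx) hy
      have ht : ((N : ℤ) + 1).toNat = N + 1 := by
        rw [show ((N : ℤ) + 1) = ((N + 1 : ℕ) : ℤ) by norm_cast, Int.toNat_natCast]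
      simpa [g, ht] using this
    · rw [𝒟₁.A_eq_zero hx, 𝒟₂.A_eq_zero (by rwa [← hS]), zero_mul, mul_zero]
  have hB : ∀ n m : ℤ, (n + 1, m - 3) ∈ 𝒟₁.S → 𝒟₁.B n m * g (n + 1) (m - 3) = g n m * 𝒟₂.B n m := by
    intro n m hy
    by_cases hx : (n, m) ∈ 𝒟₁.S
    · obtain ⟨N, rfl⟩ := cast n m hx
      have := (step N).2.2 (m - 3) (by simpa using hx) hy
      have ht : ((N : ℤ) + 1).toNat = N + 1 := by
        rw [show ((N : ℤ) + 1) = ((N + 1 : ℕ) : ℤ) by norm_cast, Int.toNat_natCast]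
      simpa [g, ht] using this
    · rw [𝒟₁.B_eq_zero hx, 𝒟₂.B_eq_zero (by rwa [← hS]), zero_mul, mul_zero]
  exact ⟨gaugeEquiv 𝒟₁ 𝒟₂ g hS hg hA hB (gaugeC_of_gaugeB hS hconn₁ hQ hB) (gaugeD_of_gaugeA hS hconn₁ hP hA)⟩

end SU21Datum

end Literature.RepresentationTheory.Kovacevic2021
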